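import Summits.ResolutionOfSingularities.ResolutionOfSingularities.Theorems.EquisingularLiftEquisingularLiftNatOneStepVertexChart
import Literature.AlgebraicGeometry.Resolution.AlterationsNormalFormBlowupFormalProofs
import HarnessLib

/-!
# [OURS] THE AFFINE ONE-STEP BRIDGE (scheme side): for the AFFINE hypersurface `Spec K[y]/(Φ + Ψ)` with one-step data (hone) at the origin, EVERY
# blow-up along the origin is regular at every point over the origin — brick B1 of the level-1 bridge of the depth programme
# (cruxes `Theses.EquisingularLift.EquisingularLiftNat` / `…NatThree` / `EquisingularLift`, stmt-ResolutionOfSingularities-20038 / -20148 / -15660)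

[OURS · leafhand-res-equisingularlift-11 g0, 2026-08-31; cell `pub/decomp-res`] AI-produced, weaker than expert review; NOT a statement of any manuscript;
nothing here proves resolution of singularities in positive characteristic.  DEF-FREE helper; no `sorry`; standard axioms; ZERO named hypotheses.

Seat res-D-pv-013's pointwise vertex theorem ✓ `OneStep.isRegularLocalRing_stalk_of_isBlowup_comap` reads the one-step datum (hone) of a PROJECTIVE
hypersurface `V₊(F)` at a coordinate VERTEX.  The depth programme's level `1` (✓ `towerLevel_succ_of_model`) needs the same statement one blow-up UP,
at a point of a chart of the first blow-up — an AFFINE hypersurface `Spec K[T]/(G_l)` at its origin, where ✓ `…NatSecondOrderA3Recognition` /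
`…SecondOrderALadder` / `…SecondOrderDLadder` deliver (hone) for `G_l`.  This file states the bridge for an arbitrary affine hypersurface through the
origin, with no projective embedding:

* ★★★ `OneStep.isRegularLocalRing_stalk_of_isBlowup_origin` — `f = Φ + Ψ ∈ K[y₀,…,y_N]`, `Φ ≠ 0` a form of degree `μ`, `Ψ ∈ (y)^{μ+1}`, and for every
  chart `a` an explicit strict transform `G_a` (`f(T_a, T_aT_j) = T_a^μ G_a`) passing the Jacobian test at every prime `P ∋ T_a, G_a`.  Then for EVERY
  blow-up `ρ : Z → Spec (K[y]/(f))` along the origin `(ȳ)` (universal property `IsBlowup`, ideal sheaf `ofIdealTop`) and every `z ∈ Z` over the origin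
  (`ρ z ∈ supp`), the local ring `𝒪_{Z,z}` is regular.  Proof: `z` lies in an affine chart `Spec (K[y]/(f))[Ī/ȳ_a] → Z` at a generator
  (✓ `IsBlowup.exists_chart_of_span_range_eq`, Stacks 0804) at a prime containing `ȳ_a`, whose localisation is regular by
  ✓ `OneStep.isRegularLocalRing_localization_blowupAlgebra`; stalks of open immersions (✓ `not_isRegularLocalRing_localization_of_stalk`).

Remaining for level `1` (B2–B4 of the census): points of the model over the VERTEX of `V₊(F)` ↔ chart origins with failing (FO); closedness; assembly through
✓ `towerLevel_succ_of_model` + ✓ `tower_loc`.  Honest label: closes no registered stub.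

References: [StacksProject, Tags 0804, 080E]; [GortzWedhorn2020, Prop. 13.91, 13.96]; [Matsumura1987, Thm. 14.2]; through the cited tree files.
-/

set_option linter.dupNamespace false -- mandated namespace `Summit.<Summit>.<Problem>` of this single-conjunct summit

noncomputable section

open CategoryTheory CategoryTheory.Limits AlgebraicGeometry TopologicalSpace
open MvPolynomial
open Literature.AlgebraicGeometry.Resolution
open AlgebraicGeometry.Scheme.IdealSheafData

namespace Summit.ResolutionOfSingularities.ResolutionOfSingularities.Cruxes.EquisingularLiftNat.Sections

namespace OneStep

set_option maxHeartbeats 800000 in -- the chart algebra `blowupAlgebra` is a subalgebra of a localisation: slow instance unification (as in …NatOneStepVertexChart)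
/-- ★★★ **THE AFFINE ONE-STEP BRIDGE.**  `f = Φ + Ψ ∈ K[y₀,…,y_N]` with `Φ ≠ 0` a form of degree `μ`, `Ψ ∈ (y)^{μ+1}`, and one-step data: for every
chart `a` a polynomial `G_a` with `f(T_a, T_aT_j) = T_a^μ·G_a` passing the Jacobian test at every prime containing `T_a` and `G_a`.  Then every blow-up
`ρ : Z → Spec (K[y]/(f))` along the origin is regular at every point of `Z` over the origin. [OURS] [cite: StacksProject, Tag 0804]
[cite: GortzWedhorn2020, Prop. 13.96] -/
theorem isRegularLocalRing_stalk_of_isBlowup_origin (K : Type) [Field K] {N : ℕ} (Φ Ψ : MvPolynomial (Fin (N + 1)) K) {μ : ℕ}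
    (hΦ : Φ.IsHomogeneous μ) (hΦ0 : Φ ≠ 0)
    (hΨ : Ψ ∈ Ideal.span (Set.range (X : Fin (N + 1) → MvPolynomial (Fin (N + 1)) K)) ^ (μ + 1))
    (hone : ∀ a : Fin (N + 1), ∃ G : MvPolynomial (Fin (N + 1)) K,
      aeval (fun j => X a * Function.update (X : Fin (N + 1) → MvPolynomial (Fin (N + 1)) K) a 1 j) (Φ + Ψ) = X a ^ μ * G ∧
      ∀ P : Ideal (MvPolynomial (Fin (N + 1)) K), P.IsPrime → (X a : MvPolynomial (Fin (N + 1)) K) ∈ P → G ∈ P → ∃ j, pderiv j G ∉ P)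
    {Z : Scheme.{0}} {ρ : Z ⟶ Spec (CommRingCat.of (MvPolynomial (Fin (N + 1)) K ⧸ Ideal.span {Φ + Ψ}))}
    (hρ : IsBlowup ρ (ofIdealTop (Ideal.map (Scheme.ΓSpecIso (CommRingCat.of (MvPolynomial (Fin (N + 1)) K ⧸ Ideal.span {Φ + Ψ}))).inv.hom (Ideal.map (Ideal.Quotient.mk (Ideal.span {Φ + Ψ})) (Ideal.span (Set.range (X : Fin (N + 1) → MvPolynomial (Fin (N + 1)) K)))))))
    (z : Z) (hz : ρ z ∈ ((ofIdealTop (Ideal.map (Scheme.ΓSpecIso (CommRingCat.of (MvPolynomial (Fin (N + 1)) K ⧸ Ideal.span {Φ + Ψ}))).inv.hom (Ideal.map (Ideal.Quotient.mk (Ideal.span {Φ + Ψ})) (Ideal.span (Set.range (X : Fin (N + 1) → MvPolynomial (Fin (N + 1)) K)))))).support : Set (Spec (CommRingCat.of (MvPolynomial (Fin (N + 1)) K ⧸ Ideal.span {Φ + Ψ}))))) :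
    IsRegularLocalRing (Z.presheaf.stalk z) := by
  classical
  -- generators of the centre: the residues of the variables
  let g : Fin (N + 1) → (MvPolynomial (Fin (N + 1)) K ⧸ Ideal.span {Φ + Ψ}) := fun i => Ideal.Quotient.mk (Ideal.span {Φ + Ψ}) (X i)
  have hg : Ideal.span (Set.range g) = (Ideal.map (Ideal.Quotient.mk (Ideal.span {Φ + Ψ})) (Ideal.span (Set.range (X : Fin (N + 1) → MvPolynomial (Fin (N + 1)) K)))) := by
    rw [Ideal.map_span, ← Set.range_comp]
    rfl
  -- a chart at a generator through `z`
  obtain ⟨a, φ, hφ, hzφ, hφρ⟩ := IsBlowup.exists_chart_of_span_range_eq (A := CommRingCat.of (MvPolynomial (Fin (N + 1)) K ⧸ Ideal.span {Φ + Ψ})) hρ g hg z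
  obtain ⟨w, hw⟩ := hzφ
  -- `ȳ_a ∈ w`: the image of `w` in `Spec A` lies on `V(I)` and `ȳ_a ∈ I`
  have hbw : algebraMap (MvPolynomial (Fin (N + 1)) K ⧸ Ideal.span {Φ + Ψ}) (blowupAlgebra (Ideal.map (Ideal.Quotient.mk (Ideal.span {Φ + Ψ})) (Ideal.span (Set.range (X : Fin (N + 1) → MvPolynomial (Fin (N + 1)) K)))) (g a)) (g a) ∈ w.asIdeal := by
    have hyw : ρ z = Spec.map (CommRingCat.ofHom (algebraMap (MvPolynomial (Fin (N + 1)) K ⧸ Ideal.span {Φ + Ψ})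
        (blowupAlgebra (Ideal.map (Ideal.Quotient.mk (Ideal.span {Φ + Ψ})) (Ideal.span (Set.range (X : Fin (N + 1) → MvPolynomial (Fin (N + 1)) K)))) (g a)))) w := by
      rw [← hw]
      exact congrArg (fun f => f w) hφρ
    have hy' := hz
    rw [hyw, Scheme.IdealSheafData.coe_support_ofIdealTop, Spec_zeroLocus, Spec.map_apply] at hy'
    have hmem : g a ∈ (Scheme.ΓSpecIso (CommRingCat.of (MvPolynomial (Fin (N + 1)) K ⧸ Ideal.span {Φ + Ψ}))).inv ⁻¹'
        ((Ideal.map (Scheme.ΓSpecIso (CommRingCat.of (MvPolynomial (Fin (N + 1)) K ⧸ Ideal.span {Φ + Ψ}))).inv.hom (Ideal.map (Ideal.Quotient.mk (Ideal.span {Φ + Ψ})) (Ideal.span (Set.range (X : Fin (N + 1) → MvPolynomial (Fin (N + 1)) K))))) : Set _) :=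
      Ideal.mem_map_of_mem _ (hg ▸ Ideal.subset_span ⟨a, rfl⟩)
    have h := (PrimeSpectrum.mem_zeroLocus _ _).mp hy' hmem
    rw [PrimeSpectrum.comap_asIdeal] at h
    exact h
  -- the chart ring's localisation at `w` is regular (the vertex-chart algebra of a one-step point)
  obtain ⟨G, hG, hjac⟩ := hone a
  haveI : w.asIdeal.IsPrime := w.isPrime
  haveI : IsRegularLocalRing (Localization.AtPrime w.asIdeal) :=
    OneStep.isRegularLocalRing_localization_blowupAlgebra K Φ Ψ hΦ hΦ0 hΨ a G hG hjac w.asIdeal hbw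
  by_contra hz'
  rw [← hw] at hz'
  exact not_isRegularLocalRing_localization_of_stalk φ w hz' inferInstance

end OneStep

end Summit.ResolutionOfSingularities.ResolutionOfSingularities.Cruxes.EquisingularLiftNat.Sections

end
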